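import Summits.QuantumFields.BalabanUV.Beta.GAN24.ArrowInnerShiftAliasCoord
import Summits.QuantumFields.BalabanUV.Beta.GAN24.AliasWeightsSum
import Summits.QuantumFields.BalabanUV.Beta.GAN24.ArrowAnchorZeroMomenta

/-!
# `BalabanUV.Beta.GAN24.ArrowInnerShiftAliasBorder` — binder row G-an2-4 / (CONV-C), road P1-fibre, row **P1-L10-F4** (`ArrowInnerShift`) of the
# L10 owner's cut `HOME/b2b-balaban-gan24-formalise-leaf-16/L10-CUT-M4.md` («(M4) scaled alias-space Neumann, two anchors»), PART 1d:
# the BORDER WEIGHTS OFF THE ZERO ALIAS (`m ≠ 0`) — they VANISH at the inner anchor `p = 0` and are `O(ρ)` on the polydisc `‖p_i‖ ≤ ρ ≤ 1/2`: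
# `(‖S(m)(p)‖/N^D)², ‖χ̂_m(p)‖² ≤ 9^D·ρ²·Π_i wMaj N (m i)`, and the Frobenius sums over the aliases are `≤ c(D)·ρ²` UNIFORMLY IN `N`

NOT IN PRINT; OUR PROOF ATTEMPT.  HONEST FRAMING (cell contract, verbatim): «discharging `BetaPertH` makes Bałaban's UV stability
UNCONDITIONAL — a real constructive-QFT result; it is NOT the continuum limit and NOT the Clay problem.»  HONEST DEPENDENCY (verbatim):
«continuum YM on T⁴ ⇐ BetaPertH ∧ nine spine estimates (0/9 proved); BetaPertH ⇐ (D1) ∧ (D4) ∧ CAP+tail; G-an2-4 gates asym, D1 and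
NE2/3/4.»  [folklore] bookkeeping estimates (products with one small factor, the alias sum `AliasWeightsSum.sum_prod_wMaj_le`); NO cited fact,
NO `def … : Prop` hypothesis, NO wall binder, NO new object (0 `def`).  NOT summit progress; nothing of (CONV-C)'s K-slot is discharged here.

## Why (row F4 of the cut, «borders m ≠ 0: Frobenius² ≤ C|p|²·Σ_m Π wMaj»; gan24-p1-g2's ratification CLAIMS l.3191 (1): «the active-pattern products
## Π 1/m_i² are summable in every D, = `wMaj` structure»)
For `m ≠ 0` the four border weights of the INNER-scaled arrow operator (owner's F1c spec l.3224, `r0 = 1`): `χ̂_m s♭_κ(m)/(N r_m²)` (EL–φ),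
`χ̂_m/r_m³` (G–c), `S(m)/(N^D r_m)` (M–μ̂), `S(m) s_κ(m)/N^{D+1}` (Q–Â) all vanish at `p = 0`; by part 1c each normalised coordinate factor is
`≤ 3·√wMaj` and at least one (active) is `≤ 2ρ·√wMaj`, so each NUMERATOR is `≤ 3^D ρ √(Π_i wMaj N (m i))` up to the displayed constants, in square;
`Σ_{m≠0} Π_i wMaj N (m i) ≤ 5^D − 1` then bounds the squared Frobenius norms of the four `m ≠ 0` border families by `c(D)·ρ²` uniformly in `N`
(the radii `1/r_m^k ≤ 1`, `r_m = N√lapR ≥ 2`, only help and are applied in the assembly, part 2).  Alias currency of `GAN24/AliasObjects`; independent of F1/F2.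

## What is proved (general `D`, `N ≥ 1`, `hp : ∀ i, ‖p i‖ ≤ ρ`, `ρ ≤ 1/2`)
* §2 `prod_le_of_one_small` (`0 ≤ a_i ≤ 9w_i ∀ i`, `a_{i₀} ≤ 9ρ² w_{i₀}` ⇒ `Π a ≤ 9^D ρ² Π w`), **`sq_norm_SAl_div_le`**
  (`m ≠ 0 ⇒ (‖S(m)(p)‖/N^D)² ≤ 9^D·ρ²·Π_i wMaj N (m i)`), **`sq_norm_chiAl_le`** (same for `χ̂_m = S♭(m)/N^D`), `sq_norm_chiAl_mul_sbAl_div_le`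
  (`‖χ̂_m·s♭_κ(m)/N‖² ≤ 18·9^D ρ² Π wMaj`), `sq_norm_SAl_mul_sAl_div_le` (`‖(S(m)/N^D)(s_κ(m)/N)‖² ≤ 18·9^D ρ² Π wMaj`).
* §3 **`sum_sq_norm_chiAl_le`**, **`sum_sq_norm_SAl_div_le`** (`Σ_{m≠0} ≤ 9^D(5^D − 1)ρ²`), **`sum_sq_norm_chiAl_mul_sbAl_div_le`**,
  **`sum_sq_norm_SAl_mul_sAl_div_le`** (`Σ_{m≠0} Σ_κ ≤ D·18·9^D(5^D − 1)ρ²`).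
Constants displayed, symbolic in `D` (TRIGGER-P1 c3); no float enters any statement.
Unit `b2b-balaban-gan24-formalise-leaf-04` (G-an2-4 formalisation swarm, gen 5), 2026-08-20.
-/

noncomputable section

open Complex Finset
open scoped BigOperators Real
open Literature.Probability.LatticeModels (TorusSite)
open Summit.QuantumFields.BalabanUV.Beta.GAN24.AliasWeights (wMaj wMaj_nonneg wMaj_zero)
open Summit.QuantumFields.BalabanUV.Beta.GAN24.AliasWeightsSum (sum_prod_wMaj_le)
open Summit.QuantumFields.BalabanUV.Beta.GAN24.AliasObjects (sAl SAl sbAl SbAl chiAl)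
open Summit.QuantumFields.BalabanUV.Beta.GAN24.ArrowAnchorZeroMomenta (exists_ne_zero_of_ne_zero)
open Summit.QuantumFields.BalabanUV.Beta.GAN24.ArrowInnerShiftAliasCoord (sq_norm_sAl_div_le_wMaj_of_ne_zero sq_norm_sbAl_div_le_wMaj_of_ne_zero
  sq_norm_sAl_div_le_nine sq_norm_sbAl_div_le_nine)

namespace Summit.QuantumFields.BalabanUV.Beta.GAN24.ArrowInnerShiftAliasBorder

variable {D : ℕ} {N : ℕ} [NeZero N]

/-! ## §2 The products over the coordinates: every `m ≠ 0` border weight is `≤ 3^D·ρ·√(Π wMaj)` in square -/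

/-- [folklore] PRODUCT WITH ONE SMALL FACTOR: if `0 ≤ a_i ≤ 9 w_i` for all `i` and `a_{i₀} ≤ 9ρ²·w_{i₀}` for some `i₀`, then `Π a ≤ 9^D ρ² Π w`. -/
theorem prod_le_of_one_small {a w : Fin D → ℝ} {ρ : ℝ} (ha0 : ∀ i, 0 ≤ a i) (ha : ∀ i, a i ≤ 9 * w i)
    {i₀ : Fin D} (hsmall : a i₀ ≤ 9 * ρ ^ 2 * w i₀) : ∏ i, a i ≤ 9 ^ D * ρ ^ 2 * ∏ i, w i := by
  have hw0 : ∀ i, 0 ≤ w i := fun i => by have := (ha0 i).trans (ha i); linarith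
  rw [← Finset.mul_prod_erase Finset.univ a (Finset.mem_univ i₀), ← Finset.mul_prod_erase Finset.univ w (Finset.mem_univ i₀)]
  have hrest : ∏ i ∈ Finset.univ.erase i₀, a i ≤ ∏ i ∈ Finset.univ.erase i₀, (9 * w i) :=
    Finset.prod_le_prod (fun i _ => ha0 i) fun i _ => ha i
  have hrest' : ∏ i ∈ Finset.univ.erase i₀, (9 * w i) = 9 ^ (D - 1) * ∏ i ∈ Finset.univ.erase i₀, w i := by
    rw [Finset.prod_mul_distrib, Finset.prod_const, Finset.card_erase_of_mem (Finset.mem_univ i₀), Finset.card_univ, Fintype.card_fin]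
  have hP0 : 0 ≤ ∏ i ∈ Finset.univ.erase i₀, w i := Finset.prod_nonneg fun i _ => hw0 i
  calc a i₀ * ∏ i ∈ Finset.univ.erase i₀, a i
      ≤ (9 * ρ ^ 2 * w i₀) * (9 ^ (D - 1) * ∏ i ∈ Finset.univ.erase i₀, w i) := by
        rw [← hrest']
        exact mul_le_mul hsmall hrest (Finset.prod_nonneg fun i _ => ha0 i) (by nlinarith [hw0 i₀, sq_nonneg ρ])
    _ = (9 ^ (D - 1) * 9) * ρ ^ 2 * (w i₀ * ∏ i ∈ Finset.univ.erase i₀, w i) := by ring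
    _ ≤ 9 ^ D * ρ ^ 2 * (w i₀ * ∏ i ∈ Finset.univ.erase i₀, w i) := by
        have hD : 1 ≤ D := by
          rcases Nat.eq_zero_or_pos D with h | h
          · subst h; exact (Fin.elim0 i₀)
          · exact h
        rw [← pow_succ, Nat.sub_add_cancel hD]

/-- [folklore] **THE BOX FACTOR OFF THE ZERO ALIAS**: `m ≠ 0 ⇒ (‖S(m)(p)‖/N^D)² ≤ 9^D·ρ²·Π_i wMaj N (m i)` (`‖p_j‖ ≤ ρ ≤ 1/2`; it VANISHES at `p = 0`). -/
theorem sq_norm_SAl_div_le {p : Fin D → ℂ} {ρ : ℝ} (hp : ∀ i, ‖p i‖ ≤ ρ) (hρ : ρ ≤ 1 / 2) {m : TorusSite D N} (hm : m ≠ 0) :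
    (‖SAl N p m‖ / (N : ℝ) ^ D) ^ 2 ≤ 9 ^ D * ρ ^ 2 * ∏ i, wMaj N (m i) := by
  obtain ⟨i₀, hi₀⟩ := exists_ne_zero_of_ne_zero hm
  have hprod : (‖SAl N p m‖ / (N : ℝ) ^ D) ^ 2 = ∏ i, (‖sAl N p m i‖ / N) ^ 2 := by
    unfold AliasObjects.SAl
    rw [norm_prod, Finset.prod_pow, Finset.prod_div_distrib, Finset.prod_const, Finset.card_univ, Fintype.card_fin]
  rw [hprod]
  have hsmall : (‖sAl N p m i₀‖ / N) ^ 2 ≤ 9 * ρ ^ 2 * wMaj N (m i₀) := by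
    have := sq_norm_sAl_div_le_wMaj_of_ne_zero hp hρ hi₀
    have hw := wMaj_nonneg N (m i₀)
    nlinarith [sq_nonneg ρ]
  exact prod_le_of_one_small (fun i => sq_nonneg _) (fun i => sq_norm_sAl_div_le_nine hp hρ m i) hsmall

/-- [folklore] **THE BLOCK PHASE OFF THE ZERO ALIAS**: `m ≠ 0 ⇒ ‖χ̂_m(p)‖² ≤ 9^D·ρ²·Π_i wMaj N (m i)` (`χ̂_m = S♭(m)/N^D` VANISHES at `p = 0`). -/
theorem sq_norm_chiAl_le {p : Fin D → ℂ} {ρ : ℝ} (hp : ∀ i, ‖p i‖ ≤ ρ) (hρ : ρ ≤ 1 / 2) {m : TorusSite D N} (hm : m ≠ 0) :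
    ‖chiAl N p m‖ ^ 2 ≤ 9 ^ D * ρ ^ 2 * ∏ i, wMaj N (m i) := by
  obtain ⟨i₀, hi₀⟩ := exists_ne_zero_of_ne_zero hm
  have hprod : ‖chiAl N p m‖ ^ 2 = ∏ i, (‖sbAl N p m i‖ / N) ^ 2 := by
    unfold AliasObjects.chiAl AliasObjects.SbAl
    rw [norm_div, norm_pow, Complex.norm_natCast, norm_prod, Finset.prod_pow, Finset.prod_div_distrib, Finset.prod_const,
      Finset.card_univ, Fintype.card_fin]
  rw [hprod]
  have hsmall : (‖sbAl N p m i₀‖ / N) ^ 2 ≤ 9 * ρ ^ 2 * wMaj N (m i₀) := by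
    have := sq_norm_sbAl_div_le_wMaj_of_ne_zero hp hρ hi₀
    have hw := wMaj_nonneg N (m i₀)
    nlinarith [sq_nonneg ρ]
  exact prod_le_of_one_small (fun i => sq_nonneg _) (fun i => sq_norm_sbAl_div_le_nine hp hρ m i) hsmall

/-- [folklore] THE `EL–φ` NUMERATOR off the zero alias: `‖χ̂_m(p)·s♭_κ(m)(p)/N‖² ≤ 18·9^D·ρ²·Π_i wMaj N (m i)` (`m ≠ 0`; the extra factor
`(‖s♭_κ‖/N)² ≤ 9·wMaj ≤ 18`). -/
theorem sq_norm_chiAl_mul_sbAl_div_le {p : Fin D → ℂ} {ρ : ℝ} (hp : ∀ i, ‖p i‖ ≤ ρ) (hρ : ρ ≤ 1 / 2) {m : TorusSite D N} (hm : m ≠ 0)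
    (κ : Fin D) : ‖chiAl N p m * (sbAl N p m κ / N)‖ ^ 2 ≤ 18 * 9 ^ D * ρ ^ 2 * ∏ i, wMaj N (m i) := by
  have h1 := sq_norm_chiAl_le hp hρ hm
  have h2 := sq_norm_sbAl_div_le_nine hp hρ m κ
  have hw2 : wMaj N (m κ) ≤ 2 := by
    unfold wMaj; split_ifs
    · norm_num
    · have ha : (((m κ).val : ℝ) ^ 2)⁻¹ ≤ 1 := by
        have hv : (1 : ℝ) ≤ (m κ).val := by
          exact_mod_cast Nat.one_le_iff_ne_zero.2 fun h0 => ‹¬m κ = 0› ((ZMod.val_eq_zero _).1 h0)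
        exact inv_le_one_of_one_le₀ (by nlinarith)
      have hb : ((((N - (m κ).val : ℕ) : ℝ)) ^ 2)⁻¹ ≤ 1 := by
        have hv : (1 : ℝ) ≤ ((N - (m κ).val : ℕ) : ℝ) := by
          have := ZMod.val_lt (m κ); exact_mod_cast (by omega : 1 ≤ N - (m κ).val)
        exact inv_le_one_of_one_le₀ (by nlinarith)
      linarith
  have hP : 0 ≤ ∏ i, wMaj N (m i) := Finset.prod_nonneg fun i _ => wMaj_nonneg N (m i)
  rw [norm_mul, mul_pow, norm_div, Complex.norm_natCast]
  calc ‖chiAl N p m‖ ^ 2 * (‖sbAl N p m κ‖ / N) ^ 2 ≤ (9 ^ D * ρ ^ 2 * ∏ i, wMaj N (m i)) * (9 * wMaj N (m κ)) :=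
        mul_le_mul h1 h2 (sq_nonneg _) (by positivity)
    _ ≤ (9 ^ D * ρ ^ 2 * ∏ i, wMaj N (m i)) * 18 := mul_le_mul_of_nonneg_left (by linarith) (by positivity)
    _ = 18 * 9 ^ D * ρ ^ 2 * ∏ i, wMaj N (m i) := by ring

/-- [folklore] THE `Q–A` NUMERATOR off the zero alias: `‖(S(m)(p)/N^D)·(s_κ(m)(p)/N)‖² ≤ 18·9^D·ρ²·Π_i wMaj N (m i)` (`m ≠ 0`). -/
theorem sq_norm_SAl_mul_sAl_div_le {p : Fin D → ℂ} {ρ : ℝ} (hp : ∀ i, ‖p i‖ ≤ ρ) (hρ : ρ ≤ 1 / 2) {m : TorusSite D N} (hm : m ≠ 0)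
    (κ : Fin D) : ‖SAl N p m / (N : ℂ) ^ D * (sAl N p m κ / N)‖ ^ 2 ≤ 18 * 9 ^ D * ρ ^ 2 * ∏ i, wMaj N (m i) := by
  have h1 := sq_norm_SAl_div_le hp hρ hm
  have h2 := sq_norm_sAl_div_le_nine hp hρ m κ
  have hw2 : wMaj N (m κ) ≤ 2 := by
    unfold wMaj; split_ifs
    · norm_num
    · have ha : (((m κ).val : ℝ) ^ 2)⁻¹ ≤ 1 := by
        have hv : (1 : ℝ) ≤ (m κ).val := by
          exact_mod_cast Nat.one_le_iff_ne_zero.2 fun h0 => ‹¬m κ = 0› ((ZMod.val_eq_zero _).1 h0)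
        exact inv_le_one_of_one_le₀ (by nlinarith)
      have hb : ((((N - (m κ).val : ℕ) : ℝ)) ^ 2)⁻¹ ≤ 1 := by
        have hv : (1 : ℝ) ≤ ((N - (m κ).val : ℕ) : ℝ) := by
          have := ZMod.val_lt (m κ); exact_mod_cast (by omega : 1 ≤ N - (m κ).val)
        exact inv_le_one_of_one_le₀ (by nlinarith)
      linarith
  have hP : 0 ≤ ∏ i, wMaj N (m i) := Finset.prod_nonneg fun i _ => wMaj_nonneg N (m i)
  rw [norm_mul, mul_pow, norm_div, norm_pow, Complex.norm_natCast, norm_div, Complex.norm_natCast]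
  calc (‖SAl N p m‖ / (N : ℝ) ^ D) ^ 2 * (‖sAl N p m κ‖ / N) ^ 2 ≤ (9 ^ D * ρ ^ 2 * ∏ i, wMaj N (m i)) * (9 * wMaj N (m κ)) :=
        mul_le_mul h1 h2 (sq_nonneg _) (by positivity)
    _ ≤ (9 ^ D * ρ ^ 2 * ∏ i, wMaj N (m i)) * 18 := mul_le_mul_of_nonneg_left (by linarith) (by positivity)
    _ = 18 * 9 ^ D * ρ ^ 2 * ∏ i, wMaj N (m i) := by ring

/-! ## §3 The alias sums: the `m ≠ 0` border share is `O(ρ²)` in Frobenius square, uniformly in `N` -/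

/-- [folklore] **`Σ_{m ≠ 0} ‖χ̂_m(p)‖² ≤ 9^D·(5^D − 1)·ρ²`** (the G–c column border off the zero alias, before the radii `1/r_m³ ≤ 1`). -/
theorem sum_sq_norm_chiAl_le {p : Fin D → ℂ} {ρ : ℝ} (hp : ∀ i, ‖p i‖ ≤ ρ) (hρ : ρ ≤ 1 / 2) :
    ∑ m ∈ (Finset.univ : Finset (TorusSite D N)).erase 0, ‖chiAl N p m‖ ^ 2 ≤ 9 ^ D * ((5 : ℝ) ^ D - 1) * ρ ^ 2 := by
  classical
  have hS := sum_prod_wMaj_le (D := D) N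
  calc ∑ m ∈ (Finset.univ : Finset (TorusSite D N)).erase 0, ‖chiAl N p m‖ ^ 2
      ≤ ∑ m ∈ (Finset.univ : Finset (TorusSite D N)).erase 0, 9 ^ D * ρ ^ 2 * ∏ i, wMaj N (m i) :=
        Finset.sum_le_sum fun m hm => sq_norm_chiAl_le hp hρ (Finset.ne_of_mem_erase hm)
    _ = 9 ^ D * ρ ^ 2 * ∑ m ∈ (Finset.univ : Finset (TorusSite D N)).erase 0, ∏ i, wMaj N (m i) := by rw [Finset.mul_sum]
    _ ≤ 9 ^ D * ρ ^ 2 * ((5 : ℝ) ^ D - 1) := mul_le_mul_of_nonneg_left hS (by positivity)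
    _ = 9 ^ D * ((5 : ℝ) ^ D - 1) * ρ ^ 2 := by ring

/-- [folklore] **`Σ_{m ≠ 0} (‖S(m)(p)‖/N^D)² ≤ 9^D·(5^D − 1)·ρ²`** (the M–μ row border off the zero alias, before the radii `1/r_m ≤ 1`). -/
theorem sum_sq_norm_SAl_div_le {p : Fin D → ℂ} {ρ : ℝ} (hp : ∀ i, ‖p i‖ ≤ ρ) (hρ : ρ ≤ 1 / 2) :
    ∑ m ∈ (Finset.univ : Finset (TorusSite D N)).erase 0, (‖SAl N p m‖ / (N : ℝ) ^ D) ^ 2 ≤ 9 ^ D * ((5 : ℝ) ^ D - 1) * ρ ^ 2 := by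
  classical
  have hS := sum_prod_wMaj_le (D := D) N
  calc ∑ m ∈ (Finset.univ : Finset (TorusSite D N)).erase 0, (‖SAl N p m‖ / (N : ℝ) ^ D) ^ 2
      ≤ ∑ m ∈ (Finset.univ : Finset (TorusSite D N)).erase 0, 9 ^ D * ρ ^ 2 * ∏ i, wMaj N (m i) :=
        Finset.sum_le_sum fun m hm => sq_norm_SAl_div_le hp hρ (Finset.ne_of_mem_erase hm)
    _ = 9 ^ D * ρ ^ 2 * ∑ m ∈ (Finset.univ : Finset (TorusSite D N)).erase 0, ∏ i, wMaj N (m i) := by rw [Finset.mul_sum]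
    _ ≤ 9 ^ D * ρ ^ 2 * ((5 : ℝ) ^ D - 1) := mul_le_mul_of_nonneg_left hS (by positivity)
    _ = 9 ^ D * ((5 : ℝ) ^ D - 1) * ρ ^ 2 := by ring

/-- [folklore] **`Σ_{m ≠ 0} Σ_κ ‖χ̂_m s♭_κ(m)/N‖² ≤ D·18·9^D·(5^D − 1)·ρ²`** (the EL–φ column border off the zero alias, before the radii `1/r_m² ≤ 1`). -/
theorem sum_sq_norm_chiAl_mul_sbAl_div_le {p : Fin D → ℂ} {ρ : ℝ} (hp : ∀ i, ‖p i‖ ≤ ρ) (hρ : ρ ≤ 1 / 2) :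
    ∑ m ∈ (Finset.univ : Finset (TorusSite D N)).erase 0, ∑ κ, ‖chiAl N p m * (sbAl N p m κ / N)‖ ^ 2
      ≤ D * 18 * 9 ^ D * ((5 : ℝ) ^ D - 1) * ρ ^ 2 := by
  classical
  have hS := sum_prod_wMaj_le (D := D) N
  calc ∑ m ∈ (Finset.univ : Finset (TorusSite D N)).erase 0, ∑ κ, ‖chiAl N p m * (sbAl N p m κ / N)‖ ^ 2
      ≤ ∑ m ∈ (Finset.univ : Finset (TorusSite D N)).erase 0, ∑ _κ : Fin D, 18 * 9 ^ D * ρ ^ 2 * ∏ i, wMaj N (m i) :=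
        Finset.sum_le_sum fun m hm => Finset.sum_le_sum fun κ _ => sq_norm_chiAl_mul_sbAl_div_le hp hρ (Finset.ne_of_mem_erase hm) κ
    _ = D * 18 * 9 ^ D * ρ ^ 2 * ∑ m ∈ (Finset.univ : Finset (TorusSite D N)).erase 0, ∏ i, wMaj N (m i) := by
        rw [Finset.mul_sum]
        refine Finset.sum_congr rfl fun m _ => ?_
        rw [Finset.sum_const, Finset.card_univ, Fintype.card_fin, nsmul_eq_mul]; ring
    _ ≤ D * 18 * 9 ^ D * ρ ^ 2 * ((5 : ℝ) ^ D - 1) := mul_le_mul_of_nonneg_left hS (by positivity)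
    _ = D * 18 * 9 ^ D * ((5 : ℝ) ^ D - 1) * ρ ^ 2 := by ring

/-- [folklore] **`Σ_{m ≠ 0} Σ_κ ‖(S(m)/N^D)(s_κ(m)/N)‖² ≤ D·18·9^D·(5^D − 1)·ρ²`** (the Q–A row border off the zero alias; no radius in the inner scaling). -/
theorem sum_sq_norm_SAl_mul_sAl_div_le {p : Fin D → ℂ} {ρ : ℝ} (hp : ∀ i, ‖p i‖ ≤ ρ) (hρ : ρ ≤ 1 / 2) :
    ∑ m ∈ (Finset.univ : Finset (TorusSite D N)).erase 0, ∑ κ, ‖SAl N p m / (N : ℂ) ^ D * (sAl N p m κ / N)‖ ^ 2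
      ≤ D * 18 * 9 ^ D * ((5 : ℝ) ^ D - 1) * ρ ^ 2 := by
  classical
  have hS := sum_prod_wMaj_le (D := D) N
  calc ∑ m ∈ (Finset.univ : Finset (TorusSite D N)).erase 0, ∑ κ, ‖SAl N p m / (N : ℂ) ^ D * (sAl N p m κ / N)‖ ^ 2
      ≤ ∑ m ∈ (Finset.univ : Finset (TorusSite D N)).erase 0, ∑ _κ : Fin D, 18 * 9 ^ D * ρ ^ 2 * ∏ i, wMaj N (m i) :=
        Finset.sum_le_sum fun m hm => Finset.sum_le_sum fun κ _ => sq_norm_SAl_mul_sAl_div_le hp hρ (Finset.ne_of_mem_erase hm) κ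
    _ = D * 18 * 9 ^ D * ρ ^ 2 * ∑ m ∈ (Finset.univ : Finset (TorusSite D N)).erase 0, ∏ i, wMaj N (m i) := by
        rw [Finset.mul_sum]
        refine Finset.sum_congr rfl fun m _ => ?_
        rw [Finset.sum_const, Finset.card_univ, Fintype.card_fin, nsmul_eq_mul]; ring
    _ ≤ D * 18 * 9 ^ D * ρ ^ 2 * ((5 : ℝ) ^ D - 1) := mul_le_mul_of_nonneg_left hS (by positivity)
    _ = D * 18 * 9 ^ D * ((5 : ℝ) ^ D - 1) * ρ ^ 2 := by ring

end Summit.QuantumFields.BalabanUV.Beta.GAN24.ArrowInnerShiftAliasBorder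

end
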